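import Summits.Ventures.PercRepro.C025ProfilePriceMono
import Summits.Ventures.PercRepro.C025ProfileOneFlatRowsTau

/-!
# THE SHIFTED ROWS OF (Π) ARE CONSEQUENCES OF THE ROWS (night-3 g27)

`proofs/NIGHT3-G27-PLD.md` §1.  For a finite matroid `M` and `b, e, t` with `e + t ≥ 1`, put `L := b + e + t`.
The SHIFTED ROW `(R_t)` of g26 (`NIGHT3-G26-TWOFLATS.md` §2),
  `Σ_{ρ(B) = b, ρ(E∖B) ≥ L} C(ρ(E∖B), e)  ≤  C(L, e) · #{S : ρ(S) = L}`,
follows from the row `(b, L)` of (Π) for the SAME matroid: the row's price at complement rank `p ≥ L` is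
`C(p+b, L)/C(p+b, b) = C(p, e+t)/C(L, e+t)` (the price identity), and the ratio `C(p, e)/C(L, e)` is at most
`C(p, e+t)/C(L, e+t)` because `C(n, e+t) = C(n, e)·Π_{l<t} (n−e−l)/(e+l+1)` and each factor `n − e − l` grows with `n`
(`choose_mul_choose_le_choose_mul_choose`, by induction on `t` with `Nat.choose_succ_right_eq`).  Hence no new
injection is needed for `(R_t)`: `shifted_row_of_profileIneq`; on night-1's model `T_r(U_{s,F} ⊕ U_{E∖F,E∖F})` every shifted row
with `b + e + t < r` holds (`shifted_rows_modelMatroid`, from g25's `OneFlat.profileIneq_rows_modelMatroid_all`) — g26's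
successor item (2), «the rule for `(R_t)` on `U_{s,k} ⊕ U_{m,m}`», needs no rule.  No `def`, no `instance`, no notation.  Axioms: standard.
-/

open scoped Matroid

namespace PercRepro

open Finset ThmH

namespace ShiftedRow

/-- **The ratio inequality**: for `L ≤ p`, `C(p, e)·C(L, e+t) ≤ C(p, e+t)·C(L, e)`. -/
theorem choose_mul_choose_le_choose_mul_choose (t : ℕ) :
    ∀ {p L e : ℕ}, L ≤ p → p.choose e * L.choose (e + t) ≤ p.choose (e + t) * L.choose e := by
  induction t with
  | zero => intro p L e _; simp
  | succ t ih =>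
    intro p L e hLp
    have hp := Nat.choose_succ_right_eq p (e + t)
    have hL := Nat.choose_succ_right_eq L (e + t)
    have hpos : 0 < e + t + 1 := by omega
    have key : p.choose e * L.choose (e + t + 1) * (e + t + 1) ≤
        p.choose (e + t + 1) * L.choose e * (e + t + 1) := by
      calc p.choose e * L.choose (e + t + 1) * (e + t + 1)
          = p.choose e * (L.choose (e + t + 1) * (e + t + 1)) := by ring
        _ = p.choose e * (L.choose (e + t) * (L - (e + t))) := by rw [hL]
        _ = p.choose e * L.choose (e + t) * (L - (e + t)) := by ring
        _ ≤ p.choose (e + t) * L.choose e * (L - (e + t)) := Nat.mul_le_mul_right _ (ih hLp)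
        _ ≤ p.choose (e + t) * L.choose e * (p - (e + t)) :=
            Nat.mul_le_mul_left _ (Nat.sub_le_sub_right hLp _)
        _ = (p.choose (e + t) * (p - (e + t))) * L.choose e := by ring
        _ = (p.choose (e + t + 1) * (e + t + 1)) * L.choose e := by rw [hp]
        _ = p.choose (e + t + 1) * L.choose e * (e + t + 1) := by ring
    rw [show e + (t + 1) = e + t + 1 by omega]
    exact Nat.le_of_mul_le_mul_right key hpos

/-- The price identity `C(p+q,u)/C(p+q,q) = C(p,u−q)/C(u,q)` (`q ≤ u`). -/
theorem choose_div_choose_eq_choose_div' {p q u : ℕ} (hqu : q ≤ u) :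
    ((p + q).choose u : ℚ) / ((p + q).choose q : ℚ) = (p.choose (u - q) : ℚ) / (u.choose q : ℚ) := by
  have h := Nat.choose_mul (n := p + q) (k := u) (s := q) hqu
  rw [Nat.add_sub_cancel] at h
  have h1 : (0 : ℚ) < ((p + q).choose q : ℚ) := by exact_mod_cast Nat.choose_pos (by omega)
  have h2 : (0 : ℚ) < (u.choose q : ℚ) := by exact_mod_cast Nat.choose_pos hqu
  rw [div_eq_div_iff h1.ne' h2.ne']
  have h' : (p + q).choose u * u.choose q = p.choose (u - q) * (p + q).choose q := by rw [h]; ring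
  exact_mod_cast h'

/-- The shifted weight is at most the price: for `L = b + e + t ≤ p`,
`C(p, e) / C(L, e) ≤ C(p+b, L) / C(p+b, b)`. -/
theorem shifted_weight_le_price {b e t p : ℕ} (hLp : b + e + t ≤ p) :
    (p.choose e : ℚ) / ((b + e + t).choose e : ℚ) ≤
      ((p + b).choose (b + e + t) : ℚ) / ((p + b).choose b : ℚ) := by
  rw [choose_div_choose_eq_choose_div' (by omega)]
  have hsub : b + e + t - b = e + t := by omega
  rw [hsub]
  have hsym : (b + e + t).choose b = (b + e + t).choose (e + t) := by
    rw [Nat.choose_symm_of_eq_add]; omega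
  rw [hsym]
  have h1 : (0 : ℚ) < ((b + e + t).choose e : ℚ) := by exact_mod_cast Nat.choose_pos (by omega)
  have h2 : (0 : ℚ) < ((b + e + t).choose (e + t) : ℚ) := by exact_mod_cast Nat.choose_pos (by omega)
  rw [div_le_div_iff₀ h1 h2]
  have := choose_mul_choose_le_choose_mul_choose t (p := p) (L := b + e + t) (e := e) hLp
  exact_mod_cast this

variable {α : Type} [DecidableEq α]

/-- **THE SHIFTED ROW `(R_t)` FROM THE ROW `(b, b+e+t)`**: for a finite matroid `M` and `e + t ≥ 1`, the row
`(b, b+e+t)` of (Π) implies `Σ_{ρ(B)=b, ρ(E∖B) ≥ b+e+t} C(ρ(E∖B), e) ≤ C(b+e+t, e)·#{S : ρ(S) = b+e+t}`. -/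
theorem shifted_row_of_profileIneq (M : Matroid α) [M.Finite] {b e t : ℕ}
    (h : Profile.ProfileIneq M b (b + e + t)) :
    (∑ B ∈ Profile.Rq M b,
        (if b + e + t ≤ (M.eRk ((gr M \ B : Finset α) : Set α)).toNat then
          ((M.eRk ((gr M \ B : Finset α) : Set α)).toNat).choose e else 0)) ≤
      (b + e + t).choose e * (Shadow.levelSet M (b + e + t)).card := by
  unfold Profile.ProfileIneq at h
  have hCpos : (0 : ℚ) < ((b + e + t).choose e : ℚ) := by exact_mod_cast Nat.choose_pos (by omega)
  -- termwise: shifted weight / C(L,e) ≤ price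
  have hterm : ∀ B ∈ Profile.Rq M b,
      ((if b + e + t ≤ (M.eRk ((gr M \ B : Finset α) : Set α)).toNat then
          ((M.eRk ((gr M \ B : Finset α) : Set α)).toNat).choose e else 0 : ℕ) : ℚ) /
        ((b + e + t).choose e : ℚ) ≤ Profile.price M b (b + e + t) B := by
    intro B _
    have hfin : M.eRk ((gr M \ B : Finset α) : Set α) ≠ ⊤ := by
      have := M.eRk_le_eRank ((gr M \ B : Finset α) : Set α)
      exact ne_top_of_le_ne_top (M.eRank_ne_top_iff.2 inferInstance) this
    obtain ⟨p, hp⟩ : ∃ p : ℕ, M.eRk ((gr M \ B : Finset α) : Set α) = (p : ℕ∞) :=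
      ⟨_, (ENat.coe_toNat hfin).symm⟩
    rw [hp, ENat.toNat_coe]
    split_ifs with hLp
    · rw [PriceMono.price_eq_of_le hp hLp]
      exact shifted_weight_le_price hLp
    · rw [Nat.cast_zero, zero_div]
      exact Profile.price_nonneg _ _ B
  have hsum : (∑ B ∈ Profile.Rq M b,
      ((if b + e + t ≤ (M.eRk ((gr M \ B : Finset α) : Set α)).toNat then
          ((M.eRk ((gr M \ B : Finset α) : Set α)).toNat).choose e else 0 : ℕ) : ℚ)) /
        ((b + e + t).choose e : ℚ) ≤ ((Shadow.levelSet M (b + e + t)).card : ℚ) := by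
    rw [sum_div]
    exact (sum_le_sum hterm).trans h
  rw [div_le_iff₀ hCpos] at hsum
  have hcast : ((∑ B ∈ Profile.Rq M b,
      (if b + e + t ≤ (M.eRk ((gr M \ B : Finset α) : Set α)).toNat then
          ((M.eRk ((gr M \ B : Finset α) : Set α)).toNat).choose e else 0) : ℕ) : ℚ) ≤
      (((b + e + t).choose e * (Shadow.levelSet M (b + e + t)).card : ℕ) : ℚ) := by
    rw [Nat.cast_sum, Nat.cast_mul]
    linarith [hsum]
  exact_mod_cast hcast

/-- **EVERY SHIFTED ROW `(R_t)` ON «`U_{r,n}` WITH ONE FAT FLAT»** (night-1's model, `s ≤ r`): for `e + t ≥ 1` and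
`b + e + t < r`, `Σ_{ρ(B)=b, ρ(E∖B) ≥ b+e+t} C(ρ(E∖B), e) ≤ C(b+e+t, e)·#{S : ρ(S) = b+e+t}`. -/
theorem shifted_rows_modelMatroid {E : Set α} (hE : E.Finite) {F : Set α} (hF : F ⊆ E) {s r : ℕ}
    (hsr : s ≤ r) {b e t : ℕ} (het : 0 < e + t) (hr : b + e + t < r) :
    haveI := modelMatroid_finite hE F s r
    (∑ B ∈ Profile.Rq (modelMatroid hE F s r) b,
        (if b + e + t ≤ ((modelMatroid hE F s r).eRk ((gr (modelMatroid hE F s r) \ B : Finset α) : Set α)).toNat then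
          (((modelMatroid hE F s r).eRk ((gr (modelMatroid hE F s r) \ B : Finset α) : Set α)).toNat).choose e
        else 0)) ≤
      (b + e + t).choose e * (Shadow.levelSet (modelMatroid hE F s r) (b + e + t)).card := by
  haveI := modelMatroid_finite hE F s r
  exact shifted_row_of_profileIneq (modelMatroid hE F s r)
    (OneFlat.profileIneq_rows_modelMatroid_all hE hF hsr b (b + e + t) (by omega) hr)

end ShiftedRow

end PercRepro
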